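import Summits.HubbardSuperconductivity.HubbardSuperconductivity.Theorems.AnisotropyChordTransferFibre3KernelDiffSum
import Summits.HubbardSuperconductivity.HubbardSuperconductivity.Theorems.AnisotropyChordTransferFibre3DyadicStep

/-!
# Route `AnisotropyChord` / H0 rotor rung: ★ the DYADIC PERIODISATION RATE `|a^{(M)}_0(r) − a^{(2M)}_0(r)| ≤ C₀·|r|²/M` — the torus kernel converges along `M, 2M, 4M, …` with an explicit rate, no continuum integral

Fifth file of the periodisation toolkit (memo ROTOR-THEORY-21 §320–§322; PartN37 `TorusKernelQuadraticLaw`; the periodisation input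
of `…Fibre3TwoHoleBSTail.dualCert_threeQuarter_of_tail`).  Assembly of `…Fibre3DyadicStep.abs_aKer_red_sub_le` (the coarse kernel
is the periodisation of the fine one; three alternating sums at the half-period points) with `…Fibre3KernelDiffSum.sum_abs_hfun_sub_le`:
* `sum_abs_hfun_sub_ey_eq` / `diffSum_ey_eq` (swap symmetry `T_{e_y}((x,y)) = T_{eₓ}((y,x))`, any modulus), `diffSum_eq_hfun`,
  `red_intCast` (`red ((x,y) mod qM) = (x,y) mod M`);
* ★★★ `abs_aKer_sub_aKer_double_le`: for every `M ≥ 1` and every integer separation `(x, y)`,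
  `|aKer M 0 (x,y) − aKer (2M) 0 (x,y)| ≤ C₀·(x² + y²)/M`, `C₀ = (15/2)(π²/2 + π⁴/4) + 3π²/16 ≈ 222` (KT units).
* Telescoping (Mathlib `cauchySeq_of_le_geometric`, `dist_le_of_le_geometric_of_tendsto`, ratio `1/2`): `aDyad M x y k = aKer (2^k M) 0 (x,y)`,
  `aDyad_dist_le`, ★ `aDyad_cauchySeq`, `aInf M x y := lim_k aDyad M x y k`, `aDyad_tendsto`, ★★★ `abs_aDyad_sub_aInf_le`:
  `|a^{(2^k M)}_0(x,y) − a_∞^{(M)}(x,y)| ≤ 2C₀(x² + y²)/(2^k M)` — the ℤ² kernel exists as a LIMIT along each dyadic chain with a quantified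
  rate, an integral-free substitute for the closed form `aInfKT` (the true law is `V(a_L − a_∞) = −|r|²/4 + O(r⁴/V)`, memo §322; the
  constants here are crude, cf. HOME/hubbard-h0-rotor-p2/PROPBS-LEAN-g2.md; that the dyadic limits of different chains coincide needs the
  general-`q` subsampling estimate and is NOT claimed).
Prover seat `hubbard-h0-rotor-p2` g2; helper for stmt-HubbardSuperconductivity-19089 (`--supports`, helper class).
WHAT THIS IS NOT: nothing here proves superconductivity in the Hubbard model; the rotor TARGET as originally worded stays
FALSE (g15 verdict).  A quantified convergence statement behind ONE analytic input (periodisation) of ONE input (HOLE₂) of ONE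
conditional reduction (rung 19089).  Mathlib + tree imports only; no sorry, no axioms.
-/

set_option linter.dupNamespace false

noncomputable section

open scoped BigOperators
open Complex Finset

namespace Summit.HubbardSuperconductivity.HubbardSuperconductivity.Theorems.AnisotropyChord.Transfer.Fibre3

namespace Subsample

/-! ## Swap symmetry of the first-difference functional -/

/-- swap symmetry of the first-difference functional: `T_{e_y}((x,y)) = T_{eₓ}((y,x))` on any torus. [folklore] -/
theorem sum_abs_hfun_sub_ey_eq (L : ℕ) [NeZero L] (x y : ℤ) :
    ∑ n : Tor L, |hfun L (((x : ℤ) : ZMod L), ((y : ℤ) : ZMod L)) (n + ey L) - hfun L (((x : ℤ) : ZMod L), ((y : ℤ) : ZMod L)) n|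
      = ∑ n : Tor L, |hfun L (((y : ℤ) : ZMod L), ((x : ℤ) : ZMod L)) (n + ex L)
          - hfun L (((y : ℤ) : ZMod L), ((x : ℤ) : ZMod L)) n| := by
  rw [← Equiv.sum_comp (Equiv.prodComm (ZMod L) (ZMod L))]
  refine Finset.sum_congr rfl fun n _ => ?_
  simp only [Equiv.prodComm_apply, Prod.swap]
  have hsw : ∀ m : Tor L, hfun L (((x : ℤ) : ZMod L), ((y : ℤ) : ZMod L)) (m.2, m.1)
      = hfun L (((y : ℤ) : ZMod L), ((x : ℤ) : ZMod L)) m := by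
    intro m
    unfold hfun gres
    rw [epsT_swap]
    have hp : phase L (m.2, m.1) (((x : ℤ) : ZMod L), ((y : ℤ) : ZMod L))
        = phase L m (((y : ℤ) : ZMod L), ((x : ℤ) : ZMod L)) :=
      phase_swap_swap L m (((y : ℤ) : ZMod L), ((x : ℤ) : ZMod L))
    rw [hp]
    have h0 : ((m.2, m.1) = (0 : Tor L)) ↔ (m = 0) := by
      constructor
      · intro h; ext <;> simp_all [Prod.ext_iff]
      · intro h; simp [h]
    simp only [h0]
  have e1 : ((n.2, n.1) : Tor L) + ey L = ((n + ex L).2, (n + ex L).1) := by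
    ext <;> simp [ex, ey]
  rw [e1, hsw, hsw]


/-! ## Assembly: the DYADIC PERIODISATION RATE `|a_M(r) − a_{2M}(r)| ≤ C·|r|²/M` at `λ = 0` -/

section Rate

variable (M : ℕ) [NeZero M] [NeZero (2 * M)]

omit [NeZero M] in
/-- `diffSum` at `λ = 0` is the first-difference functional of `hfun`. [folklore] -/
theorem diffSum_eq_hfun (d r : Tor (2 * M)) :
    diffSum M 0 d r = ∑ n : Tor (2 * M), |hfun (2 * M) r (n + d) - hfun (2 * M) r n| := rfl

omit [NeZero M] in
/-- swap symmetry: `T_{e_y}((x,y)) = T_{eₓ}((y,x))`. [folklore] -/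
theorem diffSum_ey_eq (x y : ℤ) :
    diffSum M 0 (ey (2 * M)) (((x : ℤ) : ZMod (2 * M)), ((y : ℤ) : ZMod (2 * M)))
      = diffSum M 0 (ex (2 * M)) (((y : ℤ) : ZMod (2 * M)), ((x : ℤ) : ZMod (2 * M))) := by
  rw [diffSum_eq_hfun, diffSum_eq_hfun]
  exact sum_abs_hfun_sub_ey_eq (2 * M) x y

omit [NeZero M] [NeZero (2 * M)] in
/-- reduction of integer coordinates: `red ((x, y) mod qM) = (x, y) mod M`. [folklore] -/
theorem red_intCast (q : ℕ) [NeZero (q * M)] (x y : ℤ) :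
    red M q (((x : ℤ) : ZMod (q * M)), ((y : ℤ) : ZMod (q * M))) = (((x : ℤ) : ZMod M), ((y : ℤ) : ZMod M)) := by
  have key : ∀ z : ℤ, ((((z : ℤ) : ZMod (q * M)).val : ℕ) : ZMod M) = ((z : ℤ) : ZMod M) := by
    intro z
    have h1 : (((((z : ℤ) : ZMod (q * M)).val : ℕ) : ℤ) : ZMod M) = ((((z : ℤ) : ZMod (q * M)).val : ℕ) : ZMod M) := by
      push_cast; rfl
    rw [← h1, ZMod.val_intCast, ZMod.intCast_eq_intCast_iff_dvd_sub]
    have hdvd : (M : ℤ) ∣ ((q * M : ℕ) : ℤ) := ⟨q, by push_cast; ring⟩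
    rw [Int.dvd_iff_emod_eq_zero, Int.sub_emod, ← Int.emod_emod_of_dvd z hdvd, Int.sub_self, Int.zero_emod]
  unfold red
  rw [key, key]

/-- ★★★ **THE DYADIC PERIODISATION RATE** (`λ = 0`, every `M ≥ 1`, every integer separation `r = (x, y)`):
`|a^{(M)}_0(r) − a^{(2M)}_0(r)| ≤ C₀·(x² + y²)/M`, `C₀ = (15/2)(π²/2 + π⁴/4) + 3π²/16 (≈ 222)`.
Proof: subsampling identity (`aKer_subsample`), alternating sums at the three half-period points (`abs_aKer_red_sub_le`), the
summed first-difference bound (`sum_abs_hfun_sub_le`) and the swap symmetry.  By telescoping over `M, 2M, 4M, …` the kernel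
differences `a_{2^k M}(r)` form a Cauchy sequence with an explicit rate `O(|r|²/(2^k M))` — the existence of the ℤ² limit
`a_∞(r)` with a quantified rate, WITHOUT any continuum integral (constants are crude; the true law is `|r|²/(4V)`, memo §322). [folklore] -/
theorem abs_aKer_sub_aKer_double_le (x y : ℤ) :
    |aKer M 0 (((x : ℤ) : ZMod M), ((y : ℤ) : ZMod M))
        - aKer (2 * M) 0 (((x : ℤ) : ZMod (2 * M)), ((y : ℤ) : ZMod (2 * M)))|
      ≤ (15 / 2 * (Real.pi ^ 2 / 2 + Real.pi ^ 4 / 4) + 3 * Real.pi ^ 2 / 16) * ((x : ℝ) ^ 2 + (y : ℝ) ^ 2) / M := by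
  set r : Tor (2 * M) := (((x : ℤ) : ZMod (2 * M)), ((y : ℤ) : ZMod (2 * M))) with hr
  have hstep := abs_aKer_red_sub_le M 0 r
  rw [hr, red_intCast] at hstep
  rw [← hr] at hstep
  have hTx : diffSum M 0 (ex (2 * M)) r
      ≤ (10 * (Real.pi ^ 2 / 2 + Real.pi ^ 4 / 4) * ((2 * M : ℕ) : ℝ) + Real.pi ^ 2 / 2) * ((x : ℝ) ^ 2 + (y : ℝ) ^ 2) := by
    rw [diffSum_eq_hfun, hr]
    exact sum_abs_hfun_sub_le (2 * M) x y
  have hTy : diffSum M 0 (ey (2 * M)) r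
      ≤ (10 * (Real.pi ^ 2 / 2 + Real.pi ^ 4 / 4) * ((2 * M : ℕ) : ℝ) + Real.pi ^ 2 / 2) * ((x : ℝ) ^ 2 + (y : ℝ) ^ 2) := by
    rw [hr, diffSum_ey_eq, diffSum_eq_hfun]
    have := sum_abs_hfun_sub_le (2 * M) y x
    have e : ((y : ℝ) ^ 2 + (x : ℝ) ^ 2) = ((x : ℝ) ^ 2 + (y : ℝ) ^ 2) := by ring
    rw [e] at this
    exact this
  refine hstep.trans ?_
  have hM : (0 : ℝ) < M := by exact_mod_cast Nat.pos_of_ne_zero (NeZero.ne M)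
  have hM1 : (1 : ℝ) ≤ M := by exact_mod_cast Nat.pos_of_ne_zero (NeZero.ne M)
  set K := Real.pi ^ 2 / 2 + Real.pi ^ 4 / 4 with hK
  set ρ := (x : ℝ) ^ 2 + (y : ℝ) ^ 2 with hρ
  have hKpos : 0 < K := by rw [hK]; positivity
  have hρ0 : 0 ≤ ρ := by rw [hρ]; positivity
  have hN : ((2 * M : ℕ) : ℝ) = 2 * (M : ℝ) := by push_cast; ring
  rw [hN] at hTx hTy ⊢
  have hsum : 2 * diffSum M 0 (ex (2 * M)) r + diffSum M 0 (ey (2 * M)) r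
      ≤ 3 * ((10 * K * (2 * (M : ℝ)) + Real.pi ^ 2 / 2) * ρ) := by linarith
  have hρM : ρ / (M : ℝ) ^ 2 ≤ ρ / M := by
    apply div_le_div_of_nonneg_left hρ0 hM
    nlinarith
  calc (2 * diffSum M 0 (ex (2 * M)) r + diffSum M 0 (ey (2 * M)) r) / (2 * (2 * (M : ℝ)) ^ 2)
      ≤ 3 * ((10 * K * (2 * (M : ℝ)) + Real.pi ^ 2 / 2) * ρ) / (2 * (2 * (M : ℝ)) ^ 2) := by
        gcongr
    _ = (15 / 2 * K) * (ρ / M) + (3 * Real.pi ^ 2 / 16) * (ρ / (M : ℝ) ^ 2) := by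
        field_simp
        ring
    _ ≤ (15 / 2 * K) * (ρ / M) + (3 * Real.pi ^ 2 / 16) * (ρ / M) := by
        gcongr
    _ = (15 / 2 * K + 3 * Real.pi ^ 2 / 16) * ρ / M := by ring

end Rate


/-! ## Telescoping: the dyadic limit `a_∞^{(M)}(r) := lim_k a_{2^k M}(r)` exists with rate `2C₀|r|²/(2^k M)` -/

section Limit

open Filter Topology

variable (M : ℕ) [NeZero M]

/-- the double-modulus comparison with the fine modulus as a parameter. [folklore] -/
theorem abs_aKer_sub_aKer_of_eq_double {M' N' : ℕ} [NeZero M'] [NeZero N'] (h : N' = 2 * M') (x y : ℤ) :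
    |aKer M' 0 (((x : ℤ) : ZMod M'), ((y : ℤ) : ZMod M'))
        - aKer N' 0 (((x : ℤ) : ZMod N'), ((y : ℤ) : ZMod N'))|
      ≤ (15 / 2 * (Real.pi ^ 2 / 2 + Real.pi ^ 4 / 4) + 3 * Real.pi ^ 2 / 16) * ((x : ℝ) ^ 2 + (y : ℝ) ^ 2) / M' := by
  subst h
  exact abs_aKer_sub_aKer_double_le M' x y

/-- the dyadic sequence `k ↦ a^{(2^k M)}_0(x, y)`. [folklore] -/
def aDyad (x y : ℤ) (k : ℕ) : ℝ :=
  haveI : NeZero (2 ^ k * M) := ⟨mul_ne_zero (pow_ne_zero k two_ne_zero) (NeZero.ne M)⟩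
  aKer (2 ^ k * M) 0 (((x : ℤ) : ZMod (2 ^ k * M)), ((y : ℤ) : ZMod (2 ^ k * M)))

/-- `aDyad 0 = a^{(M)}_0(x,y)` (up to the cast `2^0·M = M`). [folklore] -/
theorem aDyad_zero (x y : ℤ) :
    aDyad M x y 0 = aKer (1 * M) 0 (((x : ℤ) : ZMod (1 * M)), ((y : ℤ) : ZMod (1 * M))) := rfl

/-- the dyadic step in geometric form: `dist(a_k, a_{k+1}) ≤ (C₀ρ/M)·(1/2)^k`. [folklore] -/
theorem aDyad_dist_le (x y : ℤ) (k : ℕ) :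
    dist (aDyad M x y k) (aDyad M x y (k + 1))
      ≤ (15 / 2 * (Real.pi ^ 2 / 2 + Real.pi ^ 4 / 4) + 3 * Real.pi ^ 2 / 16) * ((x : ℝ) ^ 2 + (y : ℝ) ^ 2) / M
        * (1 / 2 : ℝ) ^ k := by
  haveI i1 : NeZero (2 ^ k * M) := ⟨mul_ne_zero (pow_ne_zero k two_ne_zero) (NeZero.ne M)⟩
  haveI i2 : NeZero (2 ^ (k + 1) * M) := ⟨mul_ne_zero (pow_ne_zero (k + 1) two_ne_zero) (NeZero.ne M)⟩
  have h : 2 ^ (k + 1) * M = 2 * (2 ^ k * M) := by ring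
  have hb := abs_aKer_sub_aKer_of_eq_double (M' := 2 ^ k * M) (N' := 2 ^ (k + 1) * M) h x y
  rw [Real.dist_eq]
  unfold aDyad
  refine hb.trans (le_of_eq ?_)
  have hM : (M : ℝ) ≠ 0 := by exact_mod_cast (NeZero.ne M)
  have h2 : (2 : ℝ) ^ k ≠ 0 := pow_ne_zero k two_ne_zero
  push_cast
  rw [one_div_pow]
  field_simp

/-- ★ the dyadic sequence is Cauchy. [folklore] -/
theorem aDyad_cauchySeq (x y : ℤ) : CauchySeq (aDyad M x y) :=
  cauchySeq_of_le_geometric (1 / 2 : ℝ) _ (by norm_num) (aDyad_dist_le M x y)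

/-- the dyadic limit `a_∞^{(M)}(x, y)`. [folklore] -/
def aInf (x y : ℤ) : ℝ := limUnder atTop (aDyad M x y)

/-- the dyadic sequence converges to `aInf`. [folklore] -/
theorem aDyad_tendsto (x y : ℤ) : Tendsto (aDyad M x y) atTop (𝓝 (aInf M x y)) :=
  tendsto_nhds_limUnder (cauchySeq_tendsto_of_complete (aDyad_cauchySeq M x y))

/-- ★★★ **PERIODISATION RATE along the dyadic chain:** `|a^{(2^k M)}_0(x,y) − a_∞^{(M)}(x,y)| ≤ 2C₀·(x² + y²)/(2^k·M)` for every
`k`; in particular (`k = 0`) `|a^{(M)}_0(r) − a_∞^{(M)}(r)| ≤ 2C₀|r|²/M`.  (The limit is taken along `M, 2M, 4M, …`; that all these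
dyadic limits coincide with a single ℤ² kernel `a_∞` — true — needs the general-`q` subsampling estimate and is not claimed here.) [folklore] -/
theorem abs_aDyad_sub_aInf_le (x y : ℤ) (k : ℕ) :
    |aDyad M x y k - aInf M x y|
      ≤ 2 * ((15 / 2 * (Real.pi ^ 2 / 2 + Real.pi ^ 4 / 4) + 3 * Real.pi ^ 2 / 16) * ((x : ℝ) ^ 2 + (y : ℝ) ^ 2))
          / (2 ^ k * M) := by
  have h := dist_le_of_le_geometric_of_tendsto (1 / 2 : ℝ) _ (by norm_num) (aDyad_dist_le M x y) (aDyad_tendsto M x y) k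
  rw [Real.dist_eq] at h
  refine h.trans (le_of_eq ?_)
  have hM : (M : ℝ) ≠ 0 := by exact_mod_cast (NeZero.ne M)
  have h2 : (2 : ℝ) ^ k ≠ 0 := pow_ne_zero k two_ne_zero
  rw [one_div_pow]
  field_simp
  ring

end Limit

end Subsample

end Summit.HubbardSuperconductivity.HubbardSuperconductivity.Theorems.AnisotropyChord.Transfer.Fibre3

end
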